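import Summits.ABC.ABC.Theses.IneffectiveSubspace
import Summits.ABC.ABC.Theorems.UniformSadicTowerFour.Negative.SLossFloor

/-!
# `UniformSadicTowerFour` (stmt-ABC-14937): constants — what `C = 1` costs at `K = 1` and `K = 2`

Negative-side calibration of the standing disprover (cycle 1, refuter-cdisprove-stmt-ABC-14937-0, 2026-08-16),
sibling of `TowerFourSubLiouville.Negative.DialCalibration.not_towerIneq4_constant_one_exponent_13_10`
(`K = 0`: with `C = 1` the exponent must exceed `13/10`, point `1 + 4374 = 4375`, `Π = 630`).
Discounting places moves the empirical frontier INTO the crux's low cells: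

* `K = 1`: the same point with `S = {3}` has bracket `3·{630}^{{3}} = 210 = rad(abc)` (the level-4
  overcharge `3²` of `3⁷` is exactly what `S` discounts), so `C = 1` needs exponent `> 39/25`
  (`quality_point_4375_at_three`, `not_uniformSadicTowerFour_one_constant_one_exponent_39_25`;
  true discounted quality `log 4375 / log 210 = 1.5679`);
* `K = 2`: Reyssat's record triple `2 + 3¹⁰·109 = 23⁵` with optimal lifts and `S = {3, 23}` has bracket
  `69·218 = 15042 = rad(abc)`, so `C = 1` needs exponent `> 81/50`
  (`quality_point_reyssat_at_three_twentythree`, `not_uniformSadicTowerFour_two_constant_one_exponent_81_50`;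
  quality `1.6299`, the abc record) — two discounted places already carry the whole empirical abc frontier.

Message for provers: any `C(K, ε)` produced for `K ≥ 2` must absorb abc quality `1.63` outright; the
`S`-free parts are bounded through `SLossFloor.sfree_dvd` (no evaluation of `Nat.primeFactors` of large
numbers is needed).  All statements inlined, no auxiliary `def`.
-/

-- `Summit.<Summit>.<Problem>` is the mandated summit-side namespace (CONVENTIONS §2); for the
-- single-conjunct summit `ABC` the two coincide, so the duplicate `ABC.ABC` is deliberate.
set_option linter.dupNamespace false

namespace Summit.ABC.ABC.Theorems.UniformSadicTowerFour.Negative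

open scoped BigOperators
open Summit.ABC.ABC.Theses.IneffectiveSubspace

/-! ## Constants: with `C = 1`, the exponent must exceed `39/25` at `K = 1` and `81/50` at `K = 2` -/

/-- **The record point at `K = 1`.** `1 + 4374 = 4375` (`4374 = 2·3⁷`, `4375 = 5⁴·7`) lifted optimally as
`x = (1,1,1,1)`, `y = (2,1,3,3)`, `z = (7,1,1,5)` has `M = 630 = 3²·70`; at `S = {3}` the bracket is
`3·{630}^{{3}} = 210 = rad(abc)` (the level-4 overcharge `3²` of `3⁷` is discounted), and
`210^{39/25} < 4375` (`K = 1`-discounted tower quality `log 4375 / log 210 = 1.5679`, the abc quality). -/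
theorem quality_point_4375_at_three :
    ∃ x y z : Fin 4 → ℕ, (∀ i, 0 < x i ∧ 0 < y i ∧ 0 < z i) ∧
      (∏ i, x i ^ (i.val + 1)) + (∏ i, y i ^ (i.val + 1)) = ∏ i, z i ^ (i.val + 1) ∧
      Nat.Coprime (∏ i, x i ^ (i.val + 1)) (∏ i, y i ^ (i.val + 1)) ∧
      ((∏ i, z i ^ (i.val + 1) : ℕ) : ℝ) = 4375 ∧
      (((∏ p ∈ ({3} : Finset ℕ), p) * ∏ p ∈ (∏ i, x i * y i * z i).primeFactors \ {3},
        p ^ (∏ i, x i * y i * z i).factorization p : ℕ) : ℝ) ≤ 210 ∧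
      (210 : ℝ) ^ ((39 : ℝ) / 25) < 4375 := by
  refine ⟨![1, 1, 1, 1], ![2, 1, 3, 3], ![7, 1, 1, 5], ?_, by decide, by decide, ?_, ?_, ?_⟩
  · intro i; fin_cases i <;> simp
  · simp [Fin.prod_univ_four]
  · have hM : (∏ i : Fin 4, (![1, 1, 1, 1] : Fin 4 → ℕ) i * (![2, 1, 3, 3] : Fin 4 → ℕ) i *
        (![7, 1, 1, 5] : Fin 4 → ℕ) i) = 9 * 70 := by
      simp [Fin.prod_univ_four]
    rw [hM, Finset.prod_singleton]
    have h9 : (9 : ℕ).primeFactors ⊆ {3} := by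
      rw [show (9 : ℕ) = 3 ^ 2 by norm_num, Nat.primeFactors_prime_pow (by norm_num) Nat.prime_three]
    have hdvd := sfree_dvd (u := 9) (v := 70) (S := {3}) (by norm_num) (by norm_num) h9
    have h70 : (∏ r ∈ (9 * 70).primeFactors \ {3}, r ^ (9 * 70).factorization r) ≤ 70 :=
      Nat.le_of_dvd (by norm_num) hdvd
    have : (3 * ∏ r ∈ (9 * 70).primeFactors \ {3}, r ^ (9 * 70).factorization r) ≤ 210 := by omega
    exact_mod_cast this
  · refine lt_of_pow_lt_pow_left₀ 25 (by norm_num) ?_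
    rw [← Real.rpow_natCast, ← Real.rpow_mul (by norm_num)]
    norm_num

/-- Hence at budget `K = 1` the crux inequality with constant `C = 1` needs exponent `> 39/25`:
`c < 1·bracket^{39/25}` fails at the point above with `S = {3}`. -/
theorem not_uniformSadicTowerFour_one_constant_one_exponent_39_25 :
    ¬ ∀ S : Finset ℕ, S.card ≤ 1 → (∀ p ∈ S, Nat.Prime p) →
      ∀ x y z : Fin 4 → ℕ, (∀ i, 0 < x i ∧ 0 < y i ∧ 0 < z i) →
      (∏ i, x i ^ (i.val + 1)) + (∏ i, y i ^ (i.val + 1)) = ∏ i, z i ^ (i.val + 1) →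
      Nat.Coprime (∏ i, x i ^ (i.val + 1)) (∏ i, y i ^ (i.val + 1)) →
      ((∏ i, z i ^ (i.val + 1) : ℕ) : ℝ) < 1 * (((∏ p ∈ S, p) *
        ∏ p ∈ (∏ i, x i * y i * z i).primeFactors \ S, p ^ (∏ i, x i * y i * z i).factorization p : ℕ) :
          ℝ) ^ ((39 : ℝ) / 25) := by
  intro h
  obtain ⟨x, y, z, hpos, heq, hcop, hc, hB, hlt⟩ := quality_point_4375_at_three
  have key := h {3} (by simp) (by simp [Nat.prime_three]) x y z hpos heq hcop
  rw [hc, one_mul] at key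
  have hmono : (((∏ p ∈ ({3} : Finset ℕ), p) * ∏ p ∈ (∏ i, x i * y i * z i).primeFactors \ {3},
      p ^ (∏ i, x i * y i * z i).factorization p : ℕ) : ℝ) ^ ((39 : ℝ) / 25) ≤
      (210 : ℝ) ^ ((39 : ℝ) / 25) :=
    Real.rpow_le_rpow (Nat.cast_nonneg _) hB (by norm_num)
  linarith

/-- **The record point at `K = 2` (Reyssat).** `2 + 3¹⁰·109 = 23⁵` lifted optimally as `x = (2,1,1,1)`,
`y = (109,3,1,9)` (`109·3²·9⁴ = 3¹⁰·109`), `z = (23,1,1,23)` (`23·23⁴ = 23⁵`) has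
`M = 3113694 = (3³·23²)·218`; at `S = {3, 23}` the bracket is `69·{M}^S = 69·218 = 15042 = rad(abc)`
(both level-4 overcharges discounted), and `15042^{81/50} < 6436343` (`K = 2`-discounted tower quality
`= abc quality 1.6299`, the record). -/
theorem quality_point_reyssat_at_three_twentythree :
    ∃ x y z : Fin 4 → ℕ, (∀ i, 0 < x i ∧ 0 < y i ∧ 0 < z i) ∧
      (∏ i, x i ^ (i.val + 1)) + (∏ i, y i ^ (i.val + 1)) = ∏ i, z i ^ (i.val + 1) ∧
      Nat.Coprime (∏ i, x i ^ (i.val + 1)) (∏ i, y i ^ (i.val + 1)) ∧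
      ((∏ i, z i ^ (i.val + 1) : ℕ) : ℝ) = 6436343 ∧
      (((∏ p ∈ ({3, 23} : Finset ℕ), p) * ∏ p ∈ (∏ i, x i * y i * z i).primeFactors \ {3, 23},
        p ^ (∏ i, x i * y i * z i).factorization p : ℕ) : ℝ) ≤ 15042 ∧
      (15042 : ℝ) ^ ((81 : ℝ) / 50) < 6436343 := by
  refine ⟨![2, 1, 1, 1], ![109, 3, 1, 9], ![23, 1, 1, 23], ?_, by decide, by decide, ?_, ?_, ?_⟩
  · intro i; fin_cases i <;> simp
  · simp [Fin.prod_univ_four]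
  · have hM : (∏ i : Fin 4, (![2, 1, 1, 1] : Fin 4 → ℕ) i * (![109, 3, 1, 9] : Fin 4 → ℕ) i *
        (![23, 1, 1, 23] : Fin 4 → ℕ) i) = (3 ^ 3 * 23 ^ 2) * 218 := by
      simp [Fin.prod_univ_four]
    have h23 : Nat.Prime 23 := by norm_num
    rw [hM, Finset.prod_pair (by norm_num)]
    have hu : (3 ^ 3 * 23 ^ 2 : ℕ).primeFactors ⊆ {3, 23} := by
      rw [Nat.primeFactors_mul (by norm_num) (by norm_num),
        Nat.primeFactors_prime_pow (by norm_num) Nat.prime_three,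
        Nat.primeFactors_prime_pow (by norm_num) h23]
      intro r hr
      simp only [Finset.mem_union, Finset.mem_singleton] at hr
      simp only [Finset.mem_insert, Finset.mem_singleton]
      exact hr
    have hdvd := sfree_dvd (u := 3 ^ 3 * 23 ^ 2) (v := 218) (S := {3, 23}) (by norm_num) (by norm_num) hu
    have h218 : (∏ r ∈ (3 ^ 3 * 23 ^ 2 * 218).primeFactors \ {3, 23},
        r ^ (3 ^ 3 * 23 ^ 2 * 218).factorization r) ≤ 218 :=
      Nat.le_of_dvd (by norm_num) hdvd
    have : (3 * 23 * ∏ r ∈ (3 ^ 3 * 23 ^ 2 * 218).primeFactors \ {3, 23},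
        r ^ (3 ^ 3 * 23 ^ 2 * 218).factorization r) ≤ 15042 := by omega
    exact_mod_cast this
  · refine lt_of_pow_lt_pow_left₀ 50 (by norm_num) ?_
    rw [← Real.rpow_natCast, ← Real.rpow_mul (by norm_num)]
    norm_num

/-- Hence at budget `K = 2` the crux inequality with constant `C = 1` needs exponent `> 81/50`: the
`2`-discounted cell already contains the full empirical abc frontier (Reyssat's quality `1.6299`). -/
theorem not_uniformSadicTowerFour_two_constant_one_exponent_81_50 :
    ¬ ∀ S : Finset ℕ, S.card ≤ 2 → (∀ p ∈ S, Nat.Prime p) →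
      ∀ x y z : Fin 4 → ℕ, (∀ i, 0 < x i ∧ 0 < y i ∧ 0 < z i) →
      (∏ i, x i ^ (i.val + 1)) + (∏ i, y i ^ (i.val + 1)) = ∏ i, z i ^ (i.val + 1) →
      Nat.Coprime (∏ i, x i ^ (i.val + 1)) (∏ i, y i ^ (i.val + 1)) →
      ((∏ i, z i ^ (i.val + 1) : ℕ) : ℝ) < 1 * (((∏ p ∈ S, p) *
        ∏ p ∈ (∏ i, x i * y i * z i).primeFactors \ S, p ^ (∏ i, x i * y i * z i).factorization p : ℕ) :
          ℝ) ^ ((81 : ℝ) / 50) := by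
  intro h
  obtain ⟨x, y, z, hpos, heq, hcop, hc, hB, hlt⟩ := quality_point_reyssat_at_three_twentythree
  have h23 : Nat.Prime 23 := by norm_num
  have key := h {3, 23} (by rw [Finset.card_pair (by norm_num)])
    (by intro r hr
        simp only [Finset.mem_insert, Finset.mem_singleton] at hr
        rcases hr with rfl | rfl
        · exact Nat.prime_three
        · exact h23) x y z hpos heq hcop
  rw [hc, one_mul] at key
  have hmono : (((∏ p ∈ ({3, 23} : Finset ℕ), p) * ∏ p ∈ (∏ i, x i * y i * z i).primeFactors \ {3, 23},
      p ^ (∏ i, x i * y i * z i).factorization p : ℕ) : ℝ) ^ ((81 : ℝ) / 50) ≤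
      (15042 : ℝ) ^ ((81 : ℝ) / 50) :=
    Real.rpow_le_rpow (Nat.cast_nonneg _) hB (by norm_num)
  linarith

end Summit.ABC.ABC.Theorems.UniformSadicTowerFour.Negative
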